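import Summits.AtomisticToContinuum.BoseEinsteinCondensation.Theorems.BECThomsonPrinciplePeriodicToDirichletDefs
import Summits.AtomisticToContinuum.BoseEinsteinCondensation.Theorems.BECThomsonPrinciplePeriodicToDirichletCutoffOccupation
import Summits.AtomisticToContinuum.BoseEinsteinCondensation.Theorems.BECThomsonPrinciplePeriodicToDirichletMergeOccupation
import Summits.AtomisticToContinuum.BoseEinsteinCondensation.Theorems.BECThomsonPrinciplePeriodicToDirichletPaddedCutoffState
import Summits.AtomisticToContinuum.BoseEinsteinCondensation.Theorems.BECThomsonPrinciplePeriodicToDirichletRewardedUpperBound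
import Summits.AtomisticToContinuum.BoseEinsteinCondensation.Theorems.BECThomsonPrinciplePeriodicToDirichletRewardSandwich

/-!
# Route `BECThomsonPrinciple`, crux `PeriodicToDirichlet` (stmt-AtomisticToContinuum-9483),
# line `reward-pays-the-wall` — the ANCHORS: torus BEC ⟹ rewarded flat-mode BEC in the Dirichlet box

This file assembles the six landed stubs of the line (`stub_cutoffEnergy` in the Defs file,
`stub_cutoffOccupation`, `stub_mergeOccupation`, `stub_paddedCutoffState`,
`stub_rewardedUpperBound`, `stub_rewardSandwich`) into the sorry-free half of the line, registered
as the stub `stub_anchors : AnchorsFromTorusBEC` of the (re-)reshaped skeleton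
`Cruxes/PeriodicToDirichlet/Lines/reward-pays-the-wall.lean`:

for every repulsive finite-range `v` there is `ρ* > 0` such that for `0 < ρ < ρ*` and every
`c > 0`, torus BEC of the genuine periodic near-minimisers with constant `c` at density `ρ`
(`TorusBECAt v ρ c`, the body of the crux hypothesis `PeriodicBEC` at `(v, ρ, c)`) implies rewarded
flat-mode BEC of the Dirichlet near-minimisers in the box of side EXACTLY `L_N(ρ)` with the
UNIFORM constant `min c 1 / 2` at EVERY reward `λ > 0` (`RewardedBoxBECAt v ρ λ (min c 1 / 2)`).

Mechanism (the line): the padded Basti–Cenatiempo–Schlein cut-off state (same density, the crux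
hypothesis used once) bounds the rewarded Dirichlet infimum, `F^D(λ)/N ≤ e₀ + θ + λ(1 - c + θ)`
for every `θ > 0`; against the exact Dirichlet floor `E₀^D/N → e₀` Griffiths' variational
sandwich gives the anchors. So the boundary condition has disappeared from the crux: over the
tree `PeriodicToDirichlet` follows from `AnchorsFromTorusBEC` and the one remaining registered
stub `Unrewarding` (the number-conserving `λ → 0⁺`/`N → ∞` un-rewarding in one cube, open) by the
glue `hasGroundStateBEC_of_rewardedBoxBECAt_zero` — see `periodicToDirichlet_of_unrewarding`
below, whose only hypothesis is the registered stub statement `Unrewarding`.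
-/

noncomputable section

open MeasureTheory Filter
open scoped ENNReal NNReal

namespace Summit.AtomisticToContinuum.BoseEinsteinCondensation.RewardPaysTheWall

open Literature.MathematicalPhysics.QuantumManyBody.BoseGas

/-- **Statement of the anchors** (registered stub `stub_anchors` of the skeleton): for every
repulsive finite-range `v` there is `ρ* > 0` such that for `0 < ρ < ρ*` and `c > 0`,
`TorusBECAt v ρ c → ∀ λ > 0, RewardedBoxBECAt v ρ λ (min c 1 / 2)`. -/
def AnchorsFromTorusBEC : Prop :=
  ∀ v : ℝ → ℝ≥0∞, IsRepulsiveFiniteRange v → ∃ ρstar : ℝ, 0 < ρstar ∧ ∀ ρ : ℝ, 0 < ρ → ρ < ρstar →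
    ∀ c : ℝ, 0 < c → TorusBECAt v ρ c → ∀ lam : ℝ, 0 < lam → RewardedBoxBECAt v ρ lam (min c 1 / 2)

/-- The planner's stub 1 (`PaddedCutoffState`) holds: assembly of the landed pieces
(`stub_paddedCutoffState` fed with `stub_cutoffEnergy`, `stub_cutoffOccupation`,
`stub_mergeOccupation`). [folklore] -/
theorem paddedCutoffState_holds : PaddedCutoffState :=
  stub_paddedCutoffState stub_cutoffEnergy.1 stub_cutoffEnergy.2.1 stub_cutoffEnergy.2.2
    stub_cutoffOccupation stub_mergeOccupation

/-- **The anchors hold** (registered stub `stub_anchors`; sorry-free from the six landed stubs):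
`ρ* = min ρ₁ ρ₂` with `ρ₁` from `stub_rewardedUpperBound paddedCutoffState_holds` and `ρ₂` from
`stub_rewardSandwich`; the torus constant `c` is weakened to `min c 1` (`TorusBECAt.mono`) so that
the `λ`-coefficient `1 - c + θ` of the rewarded upper bound stays positive. [folklore] -/
theorem stub_anchors : AnchorsFromTorusBEC := by
  intro v hv
  obtain ⟨ρ₁, hρ₁, H2⟩ := stub_rewardedUpperBound paddedCutoffState_holds v hv
  obtain ⟨ρ₂, hρ₂, H3⟩ := stub_rewardSandwich v hv
  refine ⟨min ρ₁ ρ₂, lt_min hρ₁ hρ₂, fun ρ hρ hlt c hc hT => ?_⟩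
  have hc₁ : 0 < min c 1 := lt_min hc one_pos
  exact H3 ρ hρ (hlt.trans_le (min_le_right _ _)) (min c 1) hc₁ (min_le_right c 1)
    (H2 ρ hρ (hlt.trans_le (min_le_left _ _)) (min c 1) hc₁ (min_le_right c 1)
      (TorusBECAt.mono (min_le_left c 1) hT))

/-- **The crux modulo the open stub**: `Unrewarding → PeriodicToDirichlet` (kernel-checked; the
planner's composition with the anchors discharged). Given the crux hypothesis `A = PeriodicBEC`
and an admissible `v`: `A` gives `ρ_A` and, for `ρ < ρ_A`, a constant `c(ρ) > 0` with
`TorusBECAt v ρ c` (definitional unfolding); `stub_anchors` gives rewarded flat-mode BEC with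
constant `min c 1 / 2` at every `λ > 0` for `ρ < ρ*`; `Unrewarding` removes the reward for
`ρ < ρ₃`; `hasGroundStateBEC_of_rewardedBoxBECAt_zero` gives `HasGroundStateBEC v ρ`. [folklore] -/
theorem periodicToDirichlet_of_unrewarding (h4 : Unrewarding) :
    Summit.AtomisticToContinuum.BoseEinsteinCondensation.Theses.BECThomsonPrinciple.PeriodicToDirichlet := by
  intro hA v hv
  obtain ⟨ρA, hρA, HA⟩ := hA v hv
  obtain ⟨ρs, hρs, Hs⟩ := stub_anchors v hv
  obtain ⟨ρ₃, hρ₃, H4⟩ := h4 v hv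
  refine ⟨min ρA (min ρs ρ₃), lt_min hρA (lt_min hρs hρ₃), fun ρ hρ hlt => ?_⟩
  obtain ⟨c, hc, hT⟩ := HA ρ hρ (hlt.trans_le (min_le_left _ _))
  have hR := Hs ρ hρ (hlt.trans_le ((min_le_right _ _).trans (min_le_left _ _))) c hc hT
  obtain ⟨c', hc', h0⟩ := H4 ρ hρ (hlt.trans_le ((min_le_right _ _).trans (min_le_right _ _)))
    (min c 1 / 2) (half_pos (lt_min hc one_pos)) hR
  exact hasGroundStateBEC_of_rewardedBoxBECAt_zero hρ hc' h0

end Summit.AtomisticToContinuum.BoseEinsteinCondensation.RewardPaysTheWall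

end
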